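import Mathlib
import HarnessLib
import Summits.HubbardSuperconductivity.HubbardSuperconductivity.Theses.SeamInduction
import Summits.HubbardSuperconductivity.HubbardSuperconductivity.Theorems.SeamGluingLocality.Negative.HiddenClaims

/-!
# Crux `SeamGluingLocality` (item `stmt-HubbardSuperconductivity-18509`): the kill menu

Negative-side support (standing disprover, cycle 1). Six sorry-free lemmas of the shape
`H → ¬ SeamGluingLocality`, where each `H` is a precise `Prop` over the crux's verbatim let-prefix
saying that at SOME point `(U,δ) ∈ (0,∞) × (0,3/10)` a named behaviour occurs COFINALLY in the
sizes (for every threshold pair `(M₂,L₂)` an admissible equal-width gluing `m + m` beyond it):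
paramagnetic glued tubes (`E(π/3) < E(0)`), a concave even-`N` staircase (`Δ²_N E < 0`), failure
of the exact degeneracy (`icomp_m ≤ 0` but `icomp_{2m} ≠ 0`), soft doubling (`0 < stiff_m`,
`stiff_{2m} < stiff_m/2` — the planner's CEX/stripe kill scenario), an `icomp` jump on doubling
(outside `[1/2, 3/2]·icomp_m`), and — as a corollary of the last — a width-uniform pair charge gap
(`icomp` extensive; the strategist's `NegativeGapExtensivity`, filled stripes at `(8,1/8)`).
None of the `H` is constructible with present technique (each is a ground-state phase-diagram
statement about arbitrarily large doped Hubbard tubes); they document exactly what any proof of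
the crux AS TYPED must exclude at every point of the window. Folklore; no definitions; nothing
asserts a Theses declaration.
-/

namespace Summit.HubbardSuperconductivity.SeamGluingLocality.Negative

open scoped BigOperators Topology Manifold Classical MeasureTheory ProbabilityTheory Matrix InnerProductSpace ComplexConjugate ContinuousMap
open Filter Set Function TopologicalSpace MeasureTheory
open Literature.Hubbard
open Summit.HubbardSuperconductivity.HubbardSuperconductivity.Theses.SeamInduction

/-! ## The kill menu: `¬ C` modulo a cofinal family at one point of the window

Each hypothesis below says: at SOME `(U, δ) ∈ (0,∞) × (0,3/10)`, for EVERY threshold pair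
`(M₂, L₂)` there is an admissible equal-width gluing `m + m` beyond the thresholds exhibiting the
named behaviour. Each is believed PHYSICALLY PLAUSIBLE somewhere in the window (metallic or striped
points: `(U,δ) → (0⁺, ·)` Fermi-surface shell effects — refuter U = 0 scan: `stiff < 0` on > 50 %
of free tubes at every `L ≤ 96`; `(8, 1/8)` filled stripes, QinEtAl2020) and NONE is provable with
present technique (ground states of arbitrarily large doped Hubbard tubes). -/

/-- **Kill 1 (paramagnetic glued tubes).** If at one point of the window the glued even tubes of
width `2m` have `E(π/3) < E(0)` cofinally in `(L, m)`, the crux is false (by hidden claim (i)).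
[folklore] -/
theorem seamGluingLocality_false_of_cofinalParamagnet
    (hP : open Matrix Literature.MathematicalPhysics.QuantumLattice in let H0 : ∀ (L M : ℕ) (Λ : Type) [LinearOrder Λ] [Fintype Λ], (Λ ≃ ZMod L × ZMod M) → ℝ → Matrix (Finset (Orb Λ)) (Finset (Orb Λ)) ℂ := fun _ _ Λ _ _ e U => hamiltonian (SimpleGraph.fromRel fun x y : Λ => y = e.symm ((e x).1 + 1, (e x).2) ∨ y = e.symm ((e x).1, (e x).2 + 1)) 1 U; let Tw : ∀ (L M : ℕ) [NeZero L] [NeZero M] (Λ : Type) [LinearOrder Λ] [Fintype Λ], (Λ ≃ ZMod L × ZMod M) → ℝ → Matrix (Finset (Orb Λ)) (Finset (Orb Λ)) ℂ := fun _ M _ _ _ _ _ e θ => ∑ b : ZMod M, ∑ σ : Fin 2, ((1 - Complex.exp (Complex.I * θ)) • (creation (orb (e.symm (0, b)) σ) * annihilation (orb (e.symm (-1, b)) σ)) + (1 - Complex.exp (-(Complex.I * θ))) • (creation (orb (e.symm (-1, b)) σ) * annihilation (orb (e.symm (0, b)) σ))); let E : ∀ (L M : ℕ) [NeZero L] [NeZero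 M] (Λ : Type) [LinearOrder Λ] [Fintype Λ], (Λ ≃ ZMod L × ZMod M) → ℝ → ℝ → ℕ → ℝ := fun L M _ _ Λ _ _ e U θ N => (H0 L M Λ e U + Tw L M Λ e θ).minEnergyOn (szSector N 0); let Np : ℕ → ℕ → ℝ → ℕ := fun L M δ => 2 * ⌊(1 - δ) * ((L : ℝ) * (M : ℝ)) / 2⌋₊; let stiff : ∀ (L M : ℕ) [NeZero L] [NeZero M] (Λ : Type) [LinearOrder Λ] [Fintype Λ], (Λ ≃ ZMod L × ZMod M) → ℝ → ℝ → ℝ := fun L M _ _ Λ _ _ e U δ => 2 * (L : ℝ) * (E L M Λ e U (Real.pi / 3) (Np L M δ) - E L M Λ e U 0 (Np L M δ)) / ((Real.pi / 3) ^ 2 * (M : ℝ)); ∃ U : ℝ, 0 < U ∧ ∃ δ ∈ Set.Ioo (0 : ℝ) (3 / 10), ∀ M₂ L₂ : ℕ, ∃ (L m : ℕ) (_ : NeZero L) (_ : NeZero m) (_ : NeZero (m + m)), Even L ∧ Even m ∧ M₂ ≤ m ∧ m + m ≤ L ∧ L₂ ≤ L ∧ ∃ (Λ : Type) (_ : LinearOrder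 Λ) (_ : Fintype Λ) (e : Λ ≃ ZMod L × ZMod (m + m)), stiff L (m + m) Λ e U δ < 0) :
    ¬ SeamGluingLocality := by
  intro h
  have hh := seamGluingLocality_hidden h
  dsimp only at hP hh
  obtain ⟨U, hU, δ, hδ, hP⟩ := hP
  obtain ⟨M₂, L₂, hC⟩ := hh U hU δ hδ
  obtain ⟨L, m, iL, im, iM, hL, hm, hM₂, hmL, hL₂, Λ, _, _, e, hlt⟩ := hP M₂ L₂
  obtain ⟨e', -⟩ : ∃ _e : Fin (L * m) ≃ ZMod L × ZMod m, True := ⟨finProdFinEquiv.symm.trans (Equiv.prodCongr (ZMod.finEquiv L).toEquiv (ZMod.finEquiv m).toEquiv), trivial⟩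
  obtain ⟨h0, -⟩ := hC L m m (m + m) hL hm hm hM₂ hM₂ rfl hmL hL₂ (Fin (L * m)) e' (Fin (L * m)) e' Λ e
  exact absurd h0 (not_le.mpr hlt)

/-- **Kill 2 (concave even-`N` staircase).** If at one point of the window the glued even tubes of
width `2m` have `E(N+2) + E(N−2) − 2E(N) < 0` cofinally, the crux is false (hidden claim (ii)).
[folklore] -/
theorem seamGluingLocality_false_of_cofinalConcave
    (hP : open Matrix Literature.MathematicalPhysics.QuantumLattice in let H0 : ∀ (L M : ℕ) (Λ : Type) [LinearOrder Λ] [Fintype Λ], (Λ ≃ ZMod L × ZMod M) → ℝ → Matrix (Finset (Orb Λ)) (Finset (Orb Λ)) ℂ := fun _ _ Λ _ _ e U => hamiltonian (SimpleGraph.fromRel fun x y : Λ => y = e.symm ((e x).1 + 1, (e x).2) ∨ y = e.symm ((e x).1, (e x).2 + 1)) 1 U; let Tw : ∀ (L M : ℕ) [NeZero L] [NeZero M] (Λ : Type) [LinearOrder Λ] [Fintype Λ], (Λ ≃ ZMod L × ZMod M) → ℝ → Matrix (Finset (Orb Λ)) (Finset (Orb Λ)) ℂ := fun _ M _ _ _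 _ _ e θ => ∑ b : ZMod M, ∑ σ : Fin 2, ((1 - Complex.exp (Complex.I * θ)) • (creation (orb (e.symm (0, b)) σ) * annihilation (orb (e.symm (-1, b)) σ)) + (1 - Complex.exp (-(Complex.I * θ))) • (creation (orb (e.symm (-1, b)) σ) * annihilation (orb (e.symm (0, b)) σ))); let E : ∀ (L M : ℕ) [NeZero L] [NeZero M] (Λ : Type) [LinearOrder Λ] [Fintype Λ], (Λ ≃ ZMod L × ZMod M) → ℝ → ℝ → ℕ → ℝ := fun L M _ _ Λ _ _ e U θ N => (H0 L M Λ e U + Tw L M Λ e θ).minEnergyOn (szSector N 0); let Np : ℕ → ℕ → ℝ → ℕ := fun L M δ => 2 * ⌊(1 - δ) * ((L : ℝ) * (M : ℝ)) / 2⌋₊; let icomp : ∀ (L M : ℕ) [NeZero L] [NeZero M] (Λ : Type) [LinearOrder Λ] [Fintype Λ], (Λ ≃ ZMod L × ZMod M) → ℝ → ℝ → ℝ := fun L M _ _ Λ _ _ e U δ => (L : ℝ) * (M : ℝ) * (E L M Λ e U 0 (Np L M δ + 2) + E L M Λ e U 0 (Np L M δ - 2) - 2 * E L M Λ e U 0 (Np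 L M δ)) / 4; ∃ U : ℝ, 0 < U ∧ ∃ δ ∈ Set.Ioo (0 : ℝ) (3 / 10), ∀ M₂ L₂ : ℕ, ∃ (L m : ℕ) (_ : NeZero L) (_ : NeZero m) (_ : NeZero (m + m)), Even L ∧ Even m ∧ M₂ ≤ m ∧ m + m ≤ L ∧ L₂ ≤ L ∧ ∃ (Λ : Type) (_ : LinearOrder Λ) (_ : Fintype Λ) (e : Λ ≃ ZMod L × ZMod (m + m)), icomp L (m + m) Λ e U δ < 0) :
    ¬ SeamGluingLocality := by
  intro h
  have hh := seamGluingLocality_hidden h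
  dsimp only at hP hh
  obtain ⟨U, hU, δ, hδ, hP⟩ := hP
  obtain ⟨M₂, L₂, hC⟩ := hh U hU δ hδ
  obtain ⟨L, m, iL, im, iM, hL, hm, hM₂, hmL, hL₂, Λ, _, _, e, hlt⟩ := hP M₂ L₂
  obtain ⟨e', -⟩ : ∃ _e : Fin (L * m) ≃ ZMod L × ZMod m, True := ⟨finProdFinEquiv.symm.trans (Equiv.prodCongr (ZMod.finEquiv L).toEquiv (ZMod.finEquiv m).toEquiv), trivial⟩
  obtain ⟨-, h0, -⟩ := hC L m m (m + m) hL hm hm hM₂ hM₂ rfl hmL hL₂ (Fin (L * m)) e' (Fin (L * m)) e' Λ e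
  exact absurd h0 (not_le.mpr hlt)

/-- **Kill 3 (failure of exact degeneracy).** If at one point of the window, cofinally, some part
of width `m` is unstable (`icomp_m ≤ 0`, e.g. phase separation / a concave step of the even-`N`
staircase) while the glued tube of width `2m` has `icomp_{2m} ≠ 0`, the crux is false: C forces
the glued second difference to VANISH EXACTLY (hidden claim (iii)) — a non-generic coincidence of
three sector minima. [folklore] -/
theorem seamGluingLocality_false_of_exactDegeneracyFailure
    (hP : open Matrix Literature.MathematicalPhysics.QuantumLattice in let H0 : ∀ (L M : ℕ) (Λ : Type) [LinearOrder Λ] [Fintype Λ], (Λ ≃ ZMod L × ZMod M) → ℝ → Matrix (Finset (Orb Λ)) (Finset (Orb Λ)) ℂ := fun _ _ Λ _ _ e U => hamiltonian (SimpleGraph.fromRel fun x y : Λ => y = e.symm ((e x).1 + 1, (e x).2) ∨ y = e.symm ((e x).1, (e x).2 + 1)) 1 U; let Tw : ∀ (L M : ℕ) [NeZero L] [NeZero M] (Λ : Type) [LinearOrder Λ] [Fintype Λ], (Λ ≃ ZMod L × ZMod M) → ℝ → Matrix (Finset (Orb Λ)) (Finset (Orb Λ)) ℂ := fun _ M _ _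 _ _ _ e θ => ∑ b : ZMod M, ∑ σ : Fin 2, ((1 - Complex.exp (Complex.I * θ)) • (creation (orb (e.symm (0, b)) σ) * annihilation (orb (e.symm (-1, b)) σ)) + (1 - Complex.exp (-(Complex.I * θ))) • (creation (orb (e.symm (-1, b)) σ) * annihilation (orb (e.symm (0, b)) σ))); let E : ∀ (L M : ℕ) [NeZero L] [NeZero M] (Λ : Type) [LinearOrder Λ] [Fintype Λ], (Λ ≃ ZMod L × ZMod M) → ℝ → ℝ → ℕ → ℝ := fun L M _ _ Λ _ _ e U θ N => (H0 L M Λ e U + Tw L M Λ e θ).minEnergyOn (szSector N 0); let Np : ℕ → ℕ → ℝ → ℕ := fun L M δ => 2 * ⌊(1 - δ) * ((L : ℝ) * (M : ℝ)) / 2⌋₊; let icomp : ∀ (L M : ℕ) [NeZero L] [NeZero M] (Λ : Type) [LinearOrder Λ] [Fintype Λ], (Λ ≃ ZMod L × ZMod M) → ℝ → ℝ → ℝ := fun L M _ _ Λ _ _ e U δ => (L : ℝ) * (M : ℝ) * (E L M Λ e U 0 (Np L M δ + 2) + E L M Λ e U 0 (Np L M δ - 2) - 2 * E L M Λ e U 0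 (Np L M δ)) / 4; ∃ U : ℝ, 0 < U ∧ ∃ δ ∈ Set.Ioo (0 : ℝ) (3 / 10), ∀ M₂ L₂ : ℕ, ∃ (L m : ℕ) (_ : NeZero L) (_ : NeZero m) (_ : NeZero (m + m)), Even L ∧ Even m ∧ M₂ ≤ m ∧ m + m ≤ L ∧ L₂ ≤ L ∧ ∃ (Λ' : Type) (_ : LinearOrder Λ') (_ : Fintype Λ') (e' : Λ' ≃ ZMod L × ZMod m) (Λ : Type) (_ : LinearOrder Λ) (_ : Fintype Λ) (e : Λ ≃ ZMod L × ZMod (m + m)), icomp L m Λ' e' U δ ≤ 0 ∧ icomp L (m + m) Λ e U δ ≠ 0) :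
    ¬ SeamGluingLocality := by
  intro h
  have hh := seamGluingLocality_hidden h
  dsimp only at hP hh
  obtain ⟨U, hU, δ, hδ, hP⟩ := hP
  obtain ⟨M₂, L₂, hC⟩ := hh U hU δ hδ
  obtain ⟨L, m, iL, im, iM, hL, hm, hM₂, hmL, hL₂, Λ', _, _, e', Λ, _, _, e, hle, hne⟩ := hP M₂ L₂
  obtain ⟨-, -, h0, -⟩ := hC L m m (m + m) hL hm hm hM₂ hM₂ rfl hmL hL₂ Λ' e' Λ' e' Λ e
  exact hne (h0 hle hle)

/-- **Kill 4 (soft doubling — the planner's own kill scenario, typed).** If at one point of the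
window, cofinally, a part of width `m` is stiff (`stiff_m > 0`) but the glued tube of width `2m`
has less than HALF its stiffness (`stiff_{2m} < stiff_m / 2`: e.g. C1S0 ladders gluing to a CEX /
striped / paramagnetic tube, LinBalentsFisher1997 §V), the crux is false (hidden claim (iv) with
`M′ = M″`). The factor `1/2` is absolute: `C` tolerates NO `O(1)` loss on doubling, however
small the parts' stiffness. [folklore] -/
theorem seamGluingLocality_false_of_softDoubling
    (hP : open Matrix Literature.MathematicalPhysics.QuantumLattice in let H0 : ∀ (L M : ℕ) (Λ : Type) [LinearOrder Λ] [Fintype Λ], (Λ ≃ ZMod L × ZMod M) → ℝ → Matrix (Finset (Orb Λ)) (Finset (Orb Λ)) ℂ := fun _ _ Λ _ _ e U => hamiltonian (SimpleGraph.fromRel fun x y : Λ => y = e.symm ((e x).1 + 1, (e x).2) ∨ y = e.symm ((e x).1, (e x).2 + 1)) 1 U; let Tw : ∀ (L M : ℕ) [NeZero L] [NeZero M] (Λ : Type) [LinearOrder Λ] [Fintype Λ], (Λ ≃ ZMod L × ZMod M) → ℝ → Matrix (Finset (Orb Λ)) (Finset (Orb Λ)) ℂ := fun _ M _ _ _ _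 _ e θ => ∑ b : ZMod M, ∑ σ : Fin 2, ((1 - Complex.exp (Complex.I * θ)) • (creation (orb (e.symm (0, b)) σ) * annihilation (orb (e.symm (-1, b)) σ)) + (1 - Complex.exp (-(Complex.I * θ))) • (creation (orb (e.symm (-1, b)) σ) * annihilation (orb (e.symm (0, b)) σ))); let E : ∀ (L M : ℕ) [NeZero L] [NeZero M] (Λ : Type) [LinearOrder Λ] [Fintype Λ], (Λ ≃ ZMod L × ZMod M) → ℝ → ℝ → ℕ → ℝ := fun L M _ _ Λ _ _ e U θ N => (H0 L M Λ e U + Tw L M Λ e θ).minEnergyOn (szSector N 0); let Np : ℕ → ℕ → ℝ → ℕ := fun L M δ => 2 * ⌊(1 - δ) * ((L : ℝ) * (M : ℝ)) / 2⌋₊; let stiff : ∀ (L M : ℕ) [NeZero L] [NeZero M] (Λ : Type) [LinearOrder Λ] [Fintype Λ], (Λ ≃ ZMod L × ZMod M) → ℝ → ℝ → ℝ := fun L M _ _ Λ _ _ e U δ => 2 * (L : ℝ) * (E L M Λ e U (Real.pi / 3) (Np L M δ) - E L M Λ e U 0 (Np L M δ)) / ((Real.pi / 3) ^ 2 * (M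 : ℝ)); ∃ U : ℝ, 0 < U ∧ ∃ δ ∈ Set.Ioo (0 : ℝ) (3 / 10), ∀ M₂ L₂ : ℕ, ∃ (L m : ℕ) (_ : NeZero L) (_ : NeZero m) (_ : NeZero (m + m)), Even L ∧ Even m ∧ M₂ ≤ m ∧ m + m ≤ L ∧ L₂ ≤ L ∧ ∃ (Λ' : Type) (_ : LinearOrder Λ') (_ : Fintype Λ') (e' : Λ' ≃ ZMod L × ZMod m) (Λ : Type) (_ : LinearOrder Λ) (_ : Fintype Λ) (e : Λ ≃ ZMod L × ZMod (m + m)), 0 < stiff L m Λ' e' U δ ∧ stiff L (m + m) Λ e U δ < stiff L m Λ' e' U δ / 2) :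
    ¬ SeamGluingLocality := by
  intro h
  have hh := seamGluingLocality_hidden h
  dsimp only at hP hh
  obtain ⟨U, hU, δ, hδ, hP⟩ := hP
  obtain ⟨M₂, L₂, hC⟩ := hh U hU δ hδ
  obtain ⟨L, m, iL, im, iM, hL, hm, hM₂, hmL, hL₂, Λ', _, _, e', Λ, _, _, e, hpos, hlt⟩ := hP M₂ L₂
  obtain ⟨-, -, -, h0, -⟩ := hC L m m (m + m) hL hm hm hM₂ hM₂ rfl hmL hL₂ Λ' e' Λ' e' Λ e
  have := h0 (by simpa only [min_self] using hpos)
  simp only [min_self] at this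
  linarith

/-- **Kill 5 (icomp jump on doubling).** If at one point of the window, cofinally, a compressible
part (`icomp_m > 0`) glues to a tube whose `icomp_{2m}` leaves the band `[icomp_m/2, 3·icomp_m/2]`,
the crux is false (hidden claims (v), (vi) with `M′ = M″`; `1 + M₂/M ≤ 3/2`). [folklore] -/
theorem seamGluingLocality_false_of_icompJump
    (hP : open Matrix Literature.MathematicalPhysics.QuantumLattice in let H0 : ∀ (L M : ℕ) (Λ : Type) [LinearOrder Λ] [Fintype Λ], (Λ ≃ ZMod L × ZMod M) → ℝ → Matrix (Finset (Orb Λ)) (Finset (Orb Λ)) ℂ := fun _ _ Λ _ _ e U => hamiltonian (SimpleGraph.fromRel fun x y : Λ => y = e.symm ((e x).1 + 1, (e x).2) ∨ y = e.symm ((e x).1, (e x).2 + 1)) 1 U; let Tw : ∀ (L M : ℕ) [NeZero L] [NeZero M] (Λ : Type) [LinearOrder Λ] [Fintype Λ], (Λ ≃ ZMod L × ZMod M) → ℝ → Matrix (Finset (Orb Λ)) (Finset (Orb Λ)) ℂ := fun _ M _ _ _ _ _ e θ => ∑ b : ZMod M, ∑ σ : Fin 2, ((1 - Complex.exp (Complex.I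 * θ)) • (creation (orb (e.symm (0, b)) σ) * annihilation (orb (e.symm (-1, b)) σ)) + (1 - Complex.exp (-(Complex.I * θ))) • (creation (orb (e.symm (-1, b)) σ) * annihilation (orb (e.symm (0, b)) σ))); let E : ∀ (L M : ℕ) [NeZero L] [NeZero M] (Λ : Type) [LinearOrder Λ] [Fintype Λ], (Λ ≃ ZMod L × ZMod M) → ℝ → ℝ → ℕ → ℝ := fun L M _ _ Λ _ _ e U θ N => (H0 L M Λ e U + Tw L M Λ e θ).minEnergyOn (szSector N 0); let Np : ℕ → ℕ → ℝ → ℕ := fun L M δ => 2 * ⌊(1 - δ) * ((L : ℝ) * (M : ℝ)) / 2⌋₊; let icomp : ∀ (L M : ℕ) [NeZero L] [NeZero M] (Λ : Type) [LinearOrder Λ] [Fintype Λ], (Λ ≃ ZMod L × ZMod M) → ℝ → ℝ → ℝ := fun L M _ _ Λ _ _ e U δ => (L : ℝ) * (M : ℝ) * (E L M Λ e U 0 (Np L M δ + 2) + E L M Λ e U 0 (Np L M δ - 2) - 2 * E L M Λ e U 0 (Np L M δ)) / 4; ∃ U : ℝ, 0 < U ∧ ∃ δ ∈ Set.Ioo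 (0 : ℝ) (3 / 10), ∀ M₂ L₂ : ℕ, ∃ (L m : ℕ) (_ : NeZero L) (_ : NeZero m) (_ : NeZero (m + m)), Even L ∧ Even m ∧ M₂ ≤ m ∧ m + m ≤ L ∧ L₂ ≤ L ∧ ∃ (Λ' : Type) (_ : LinearOrder Λ') (_ : Fintype Λ') (e' : Λ' ≃ ZMod L × ZMod m) (Λ : Type) (_ : LinearOrder Λ) (_ : Fintype Λ) (e : Λ ≃ ZMod L × ZMod (m + m)), 0 < icomp L m Λ' e' U δ ∧ (icomp L (m + m) Λ e U δ < icomp L m Λ' e' U δ / 2 ∨ 3 / 2 * icomp L m Λ' e' U δ < icomp L (m + m) Λ e U δ)) :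
    ¬ SeamGluingLocality := by
  intro h
  dsimp only at hP
  obtain ⟨U, hU, δ, hδ, hP⟩ := hP
  obtain ⟨M₂, L₂, hC⟩ := h U hU δ hδ
  obtain ⟨L, m, iL, im, iM, hL, hm, hM₂, hmL, hL₂, Λ', _, _, e', Λ, _, _, e, hpos, hjump⟩ := hP M₂ L₂
  obtain ⟨-, h2, h3⟩ := hC L m m (m + m) hL hm hm hM₂ hM₂ rfl hmL hL₂ Λ' e' Λ' e' Λ e
  simp only [min_self, max_self] at h2 h3
  have hm0 : (0 : ℝ) < m := by exact_mod_cast Nat.pos_of_ne_zero (NeZero.ne m)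
  have hM₂m : (M₂ : ℝ) ≤ m := by exact_mod_cast hM₂
  have ha : (M₂ : ℝ) / ((m + m : ℕ) : ℝ) ≤ 1 / 2 := by
    have hmm : ((m + m : ℕ) : ℝ) = m + m := by push_cast; ring
    rw [hmm, div_le_iff₀ (by positivity)]; linarith
  exact jump_arith ha hpos h2 h3 hjump

/-- HYPOTHESIS of Kill 6 restated from the strategist's `NegativeGapExtensivity.lean` (crux
workfile, not importable from here): **width-uniform pair charge gap at some point of the window**
— there are `U > 0`, `δ ∈ (0,3/10)`, `0 < g`, `G < 4g/3`, `m₀` such that every even width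
`m ≥ m₀` has, for all long even `L` and every labelling, `g·L·m ≤ icomp_{L,m} ≤ G·L·m`
(two-particle charge gap `Δ²_N E ∈ [4g, 4G]`, nearly width-independent; heuristically the
filled-stripe insulator at `(8, 1/8)`, QinEtAl2020 — an OPEN statement, proved nowhere).
**Kill 6.** It contradicts the crux: `icomp` is then EXTENSIVE, so doubling the width doubles it,
against the ceiling factor `3/2` (Kill 5). Credit: planner-cstrat-…-18509-b1
(`not_seamGluingLocality_of_uniformPairGap`); re-derived here as a corollary of Kill 5. [folklore] -/
theorem seamGluingLocality_false_of_uniformPairGap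
    (hgap : open Matrix Literature.MathematicalPhysics.QuantumLattice in let H0 : ∀ (L M : ℕ) (Λ : Type) [LinearOrder Λ] [Fintype Λ], (Λ ≃ ZMod L × ZMod M) → ℝ → Matrix (Finset (Orb Λ)) (Finset (Orb Λ)) ℂ := fun _ _ Λ _ _ e U => hamiltonian (SimpleGraph.fromRel fun x y : Λ => y = e.symm ((e x).1 + 1, (e x).2) ∨ y = e.symm ((e x).1, (e x).2 + 1)) 1 U; let Tw : ∀ (L M : ℕ) [NeZero L] [NeZero M] (Λ : Type) [LinearOrder Λ] [Fintype Λ], (Λ ≃ ZMod L × ZMod M) → ℝ → Matrix (Finset (Orb Λ)) (Finset (Orb Λ)) ℂ := fun _ M _ _ _ _ _ e θ => ∑ b : ZMod M, ∑ σ : Fin 2, ((1 - Complex.exp (Complex.I * θ)) • (creation (orb (e.symm (0, b)) σ) * annihilation (orb (e.symm (-1, b)) σ)) + (1 - Complex.exp (-(Complex.I * θ))) • (creation (orb (e.symm (-1, b)) σ) * annihilation (orb (e.symm (0, b)) σ))); let E : ∀ (L M : ℕ) [NeZero L] [NeZero M] (Λ : Type) [LinearOrder Λ] [Fintype Λ],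 (Λ ≃ ZMod L × ZMod M) → ℝ → ℝ → ℕ → ℝ := fun L M _ _ Λ _ _ e U θ N => (H0 L M Λ e U + Tw L M Λ e θ).minEnergyOn (szSector N 0); let Np : ℕ → ℕ → ℝ → ℕ := fun L M δ => 2 * ⌊(1 - δ) * ((L : ℝ) * (M : ℝ)) / 2⌋₊; let icomp : ∀ (L M : ℕ) [NeZero L] [NeZero M] (Λ : Type) [LinearOrder Λ] [Fintype Λ], (Λ ≃ ZMod L × ZMod M) → ℝ → ℝ → ℝ := fun L M _ _ Λ _ _ e U δ => (L : ℝ) * (M : ℝ) * (E L M Λ e U 0 (Np L M δ + 2) + E L M Λ e U 0 (Np L M δ - 2) - 2 * E L M Λ e U 0 (Np L M δ)) / 4; ∃ U : ℝ, 0 < U ∧ ∃ δ ∈ Set.Ioo (0 : ℝ) (3 / 10), ∃ g G : ℝ, 0 < g ∧ G < 4 / 3 * g ∧ ∃ m₀ : ℕ, ∀ (m : ℕ) [NeZero m], Even m → m₀ ≤ m → ∃ L₁ : ℕ, ∀ (L : ℕ) [NeZero L], Even L → m ≤ L → L₁ ≤ L → ∀ (Λ : Type) [LinearOrder Λ] [Fintype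 Λ] (e : Λ ≃ ZMod L × ZMod m), g * L * m ≤ icomp L m Λ e U δ ∧ icomp L m Λ e U δ ≤ G * L * m) :
    ¬ SeamGluingLocality := by
  refine seamGluingLocality_false_of_icompJump ?_
  dsimp only at hgap ⊢
  obtain ⟨U, hU, δ, hδ, g, G, hg, hG, m₀, hgap⟩ := hgap
  refine ⟨U, hU, δ, hδ, ?_⟩
  intro M₂ L₂
  obtain ⟨m, hmE, hmM₂, hmm₀, hm0⟩ : ∃ m : ℕ, Even m ∧ M₂ ≤ m ∧ m₀ ≤ m ∧ 0 < m :=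
    ⟨2 * (M₂ + m₀ + 1), even_two_mul _, by omega, by omega, by omega⟩
  haveI im : NeZero m := ⟨by omega⟩
  haveI iM : NeZero (m + m) := ⟨by omega⟩
  have hME : Even (m + m) := ⟨m, rfl⟩
  obtain ⟨L₁, hm₁⟩ := @hgap m im hmE hmm₀
  obtain ⟨L₁', hM₁⟩ := @hgap (m + m) iM hME (by omega)
  obtain ⟨L, hLE, hL1, hL2, hL3, hL4⟩ :
      ∃ L : ℕ, Even L ∧ L₁ ≤ L ∧ L₁' ≤ L ∧ L₂ ≤ L ∧ m + m ≤ L :=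
    ⟨2 * (L₁ + L₁' + L₂ + m + 1), even_two_mul _, by omega, by omega, by omega, by omega⟩
  haveI iL : NeZero L := ⟨by omega⟩
  obtain ⟨e', -⟩ : ∃ _e : Fin (L * m) ≃ ZMod L × ZMod m, True := ⟨finProdFinEquiv.symm.trans (Equiv.prodCongr (ZMod.finEquiv L).toEquiv (ZMod.finEquiv m).toEquiv), trivial⟩
  obtain ⟨e, -⟩ : ∃ _e : Fin (L * (m + m)) ≃ ZMod L × ZMod (m + m), True :=
    ⟨finProdFinEquiv.symm.trans (Equiv.prodCongr (ZMod.finEquiv L).toEquiv (ZMod.finEquiv (m + m)).toEquiv), trivial⟩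
  obtain ⟨hlo', hhi'⟩ := @hm₁ L iL hLE (by omega) hL1 (Fin (L * m)) _ _ e'
  obtain ⟨hlo, -⟩ := @hM₁ L iL hLE hL4 hL2 (Fin (L * (m + m))) _ _ e
  refine ⟨L, m, iL, im, iM, hLE, hmE, hmM₂, hL4, hL3, Fin (L * m), inferInstance, inferInstance, e',
    Fin (L * (m + m)), inferInstance, inferInstance, e, ?_, Or.inr ?_⟩
  · have hL0 : (0 : ℝ) < L := by exact_mod_cast Nat.pos_of_ne_zero (NeZero.ne L)
    have hm0R : (0 : ℝ) < m := by exact_mod_cast hm0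
    have : 0 < g * L * m := by positivity
    linarith
  · have hL0 : (0 : ℝ) < L := by exact_mod_cast Nat.pos_of_ne_zero (NeZero.ne L)
    have hm0R : (0 : ℝ) < m := by exact_mod_cast hm0
    have h2g : g * (L : ℝ) * ((m + m : ℕ) : ℝ) = 2 * (g * L * m) := by push_cast; ring
    rw [h2g] at hlo
    have hLm : 0 < (L : ℝ) * m := by positivity
    nlinarith [mul_lt_mul_of_pos_right hG hLm, mul_pos hg hLm]

end Summit.HubbardSuperconductivity.SeamGluingLocality.Negative
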